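import Summits.ValiantsHypothesis.ValiantsHypothesis.Theorems.FifoMatchingNNDivisionHardFaceBlind
import Summits.ValiantsHypothesis.ValiantsHypothesis.Theorems.FifoMatchingNNDivisionHardLowDimFace

/-!
# FACE-BLIND / GENERATOR form of the located read on the zonotope chapter of COR-VIRTUAL (crux `NNDivisionHard`, stmt-ValiantsHypothesis-21181) — part 2/5 — §11: P-R1b first link, the ONE-CUT RUNG FOR ZONOTOPES `zonoGenBlindAtDecided_holds`

Theorems-side port (val-port-1 g3, presser; desk RULING #357 (A); declaration texts VERBATIM) of val-idea-41 g3's crux workfile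
`Cruxes/NNDivisionHard/FaceBlind.lean` REV 7 @025cc0a9aa76 (sha16 588eb2e00eeb6290, 1599 l.; critic of record val-idea-crit-9 g2 VERDICT #43:
VERIFIED, KEEP §G(4)+(3), axioms standard), split by the 400-line cap into five chained modules `…FaceBlind` (§1–§10: typed statements,
`captureIffRefines`, `classZReduction`, `zonoEnemy_covers`) → `…FaceBlindRung` (§11: `zonoGenBlindAtDecided_holds`) → `…FaceBlindFewZones`
(§12: `fewZonesLaw_oneBlock`) → `…FaceBlindCliqueZone` (§13: `covZonoHard_cliqueZone`) → `…FaceBlindCount` (§14: `covZonoHardClique_holds`).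
DEDUP (desk: import, do not copy): the workfile's verbatim pastes of landed declarations are REPLACED by imports — `Jdir` :=
`ExposedFibre.Jdir` (✓ `…ExposedFibreRung`), `exists_large_avoid` / `exists_generic_comb` := `LowDim.*` (✓ `…LowDimFace`), `chi` / `uVec` / `uPush` /
`sum_uVec_chi` / `negRankOne_dot_corVec` / `sum_uPush_chi` := `ConePricing.*` (✓ `…ConePricing`); the pasted one-cut-rung lemmas of val-idea-40
(`admissible_blockDir`, `Admissible.dot_eq_zero_iff/dot_le/face_eq`, `exposedFibreRung_holds`, `exposedFibreDecided_holds`) keep their FOLDED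
statements here and are PROVED BY CITATION of the δ-unfolded landed theorems `ExposedFibre.*` (✓ p674xxx `…ExposedFibreRung`, val-port-4 g3 /
val-idea-40 g4).  Namespace `…Theorems.FifoMatching.FaceBlind` (workfile: `…Cruxes.NNDivisionHard.FaceBlind41`).

* §11a val-idea-40's currency `BlockConst`, `Admissible`, `ExposedFibreBlind`, `ExposedFibreRung`, `ExposedFibreDecided` (folded statements as in the workfile;
  proofs = citations of the landed δ-unfolded `ExposedFibre.*`).
* §11b (new, val-idea-41 g3) `exists_admissible_sep` (a generic ADMISSIBLE direction separating every non-`W_β` zone), `maximiser_signs`, `maximisers_differ_by_J`,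
  ★ `zonoGenBlindAtDecided_holds : ZonoGenBlindAtDecided`, `classZ_of_covZonoHard : CovZonoHard → ClassZ`, `zonoEnemy_covers'` ((Z1) unconditional).

HONEST LABEL: helper rows for an OPEN crux (21181 `NNDivisionHard` OPEN; `CovZonoHard` OPEN for general zonotopal passengers); nothing here is a
summit statement; VP ≠ VNP is NOT proved.
-/

set_option autoImplicit false
set_option linter.dupNamespace false

noncomputable section
open Matrix Finset
open scoped Pointwise

namespace Summit.ValiantsHypothesis.ValiantsHypothesis.Theorems.FifoMatching.FaceBlind

open Literature.Barriers.PneNP (HasEFOfSize)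
open Literature.Combinatorics.Optimization (corPolytopeGraph corVec)
open Summit.ValiantsHypothesis.ValiantsHypothesis.Theorems.FifoMatching.ExposedFibre (Jdir)

variable {n m : ℕ}

/-! ## 11. P-R1b, first link — the ONE-CUT RUNG FOR ZONOTOPES in kernel: `zonoGenBlindAtDecided_holds`

(crit-9 VERDICT #17/#31: «`ZonoGenBlindAtDecided` ≈ 40's `exists_generic_comb` + ONE `face_add_face₁` + PROP A at K = 2».)
§11a pastes val-idea-40's genericity lemmas (`DimensionRung.lean`, g2) and one-cut rung (`ExposedFibre.lean` rev 3 §0–§1b,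
g3) VERBATIM — cited by paste because Cruxes modules are not importable on the farm; §11b is new: a generic ADMISSIBLE
direction separating every non-`W_β` zone (`exists_admissible_sep`), the exchange argument on maximising subset sums, and the
assembly. -/

section PastedFromValIdea40
open Summit.ValiantsHypothesis.ValiantsHypothesis.Theorems.FifoMatching.LocatedFaceExposure
open Summit.ValiantsHypothesis.ValiantsHypothesis.Theorems.FifoMatching.XcDivision
open Summit.ValiantsHypothesis.ValiantsHypothesis.Theorems.FifoMatching.LowDim (exists_large_avoid exists_generic_comb)
-- `exists_large_avoid`, `exists_generic_comb` (val-idea-40 g2, `DimensionRung.lean`) are the LANDED `LowDim.*` (✓ `…LowDimFace`) — reused by name.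

/-- [val-idea-40 g3, `ExposedFibre.lean` §0, verbatim] a `0/1` vector constant on the blocks of `β`. -/
def BlockConst (β : Fin n → Fin m) (b : Fin n → Bool) : Prop := ∀ p q, β p = β q → b p = b q

/-- [40 §0, verbatim] ADMISSIBLE (located) direction for `F_β`: vanishes on the block-constant vertices of `COR(K_n)` and is
strictly negative on every other vertex. -/
def Admissible (β : Fin n → Fin m) (c : Fin n × Fin n → ℝ) : Prop :=
  (∀ b, BlockConst β b → c ⬝ᵥ corVec (⊤ : SimpleGraph (Fin n)) b = 0) ∧
  (∀ b, ¬ BlockConst β b → c ⬝ᵥ corVec (⊤ : SimpleGraph (Fin n)) b < 0)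

/-- [40 §0, verbatim] the engine's direction `C₀^β` is admissible. -/
theorem admissible_blockDir (β : Fin n → Fin m) : ∃ c : Fin n × Fin n → ℝ, Admissible β c :=
  ExposedFibre.admissible_blockDir β

/-- [40 §1, verbatim] CLASS E♭ — some admissible direction whose maximisers among the `q j` pairwise differ by multiples of `J`. -/
def ExposedFibreBlind (β : Fin n → Fin m) {J : Type} (q : J → (Fin n × Fin n → ℝ)) : Prop :=
  ∃ c : Fin n × Fin n → ℝ, Admissible β c ∧
    ∀ j j', (∀ k, c ⬝ᵥ q k ≤ c ⬝ᵥ q j) → (∀ k, c ⬝ᵥ q k ≤ c ⬝ᵥ q j') → ∃ α : ℝ, q j - q j' = α • Jdir n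

/-- [40 §1, verbatim] ONE-CUT RUNG. -/
def ExposedFibreRung : Prop :=
  ∀ (n m : ℕ) (β : Fin n → Fin m) (ρ : Fin m → Fin n), (∀ t, β (ρ t) = t) →
    ∀ (K : ℕ) (q : Fin (K + 1) → (Fin n × Fin n → ℝ)) (r : ℕ),
      ExposedFibreBlind β q →
      HasEFOfSize (corPolytopeGraph (⊤ : SimpleGraph (Fin n)) + convexHull ℝ (Set.range q)) r →
        ∃ q' : Fin 2 → (Fin m × Fin m → ℝ),
          HasEFOfSize (corPolytopeGraph (⊤ : SimpleGraph (Fin m)) + convexHull ℝ (Set.range q')) r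

/-- [40 §1, verbatim] … hence the count `3^m ≤ (r+1)·2^(m+1)`. -/
def ExposedFibreDecided : Prop :=
  ∀ (n m : ℕ) (β : Fin n → Fin m) (ρ : Fin m → Fin n), (∀ t, β (ρ t) = t) →
    ∀ (K : ℕ) (q : Fin (K + 1) → (Fin n × Fin n → ℝ)) (r : ℕ),
      ExposedFibreBlind β q →
      HasEFOfSize (corPolytopeGraph (⊤ : SimpleGraph (Fin n)) + convexHull ℝ (Set.range q)) r →
        3 ^ m ≤ (r + 1) * 2 ^ (m + 1)

/-- [40 §1b, verbatim] -/
theorem Admissible.dot_eq_zero_iff {β : Fin n → Fin m} {c : Fin n × Fin n → ℝ} (hc : Admissible β c)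
    (b : Fin n → Bool) : c ⬝ᵥ corVec (⊤ : SimpleGraph (Fin n)) b = 0 ↔ BlockConst β b :=
  ExposedFibre.admissible_dot_eq_zero_iff hc b

/-- [40 §1b, verbatim] -/
theorem Admissible.dot_le {β : Fin n → Fin m} {c : Fin n × Fin n → ℝ} (hc : Admissible β c)
    (b : Fin n → Bool) : c ⬝ᵥ corVec (⊤ : SimpleGraph (Fin n)) b ≤ 0 :=
  ExposedFibre.admissible_dot_le hc b

/-- [40 §1b, verbatim] the `c`-face of `COR(K_n)` IS the contraction face `F_β`. -/
theorem Admissible.face_eq {β : Fin n → Fin m} {c : Fin n × Fin n → ℝ} (hc : Admissible β c)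
    {B : Fin n × Fin n → ℝ}
    (hB : ∀ x : Fin n × Fin n → ℝ,
      B ⬝ᵥ x = ∑ p : Fin n, ∑ q : Fin n, if β q = β p ∧ q ≠ p then x (p, q) - x (p, p) else 0) :
    corPolytopeGraph (⊤ : SimpleGraph (Fin n)) ∩ {x | c ⬝ᵥ x = 0} =
      corPolytopeGraph (⊤ : SimpleGraph (Fin n)) ∩ {x | B ⬝ᵥ x = 0} :=
  ExposedFibre.admissible_face_eq hc hB

open Classical in
/-- [40 §1b, verbatim] ★ THE ONE-CUT RUNG HOLDS. -/
theorem exposedFibreRung_holds : ExposedFibreRung :=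
  fun n m β ρ hρ K q r hE hEF => ExposedFibre.exposedFibreRung_holds n m β ρ hρ K q r hE hEF

/-- [40 §1b, verbatim] ★ … hence the count (PROP A at `K = 2`). -/
theorem exposedFibreDecided_holds : ExposedFibreDecided :=
  fun n m β ρ hρ K q r hE hEF => ExposedFibre.exposedFibreDecided_holds n m β ρ hρ K q r hE hEF

/-! ### §11b (new) the generic admissible separator and the rung for zonotopes -/

/-- a linear functional on `ι → ℝ` is a dot product. -/
theorem dual_eq_dotProduct {ι : Type} [Fintype ι] [DecidableEq ι] (f : Module.Dual ℝ (ι → ℝ)) (x : ι → ℝ) :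
    f x = (fun i => f (Pi.single i 1)) ⬝ᵥ x := by
  have hx : x = ∑ i, x i • (Pi.single i (1 : ℝ) : ι → ℝ) := by
    ext j
    simp [Finset.sum_apply, Pi.single_apply]
  conv_lhs => rw [hx]
  simp only [map_sum, map_smul, smul_eq_mul, dotProduct]
  exact Finset.sum_congr rfl fun i _ => mul_comm _ _

/-- a zone outside `W_β` (not a symmetric block-constant matrix) is SEEN by a functional vanishing on all block-constant
vertices of `COR(K_n)` (finite-dimensional duality + ✓ `blockConstSym_of_mem_span`). -/
theorem exists_sep (β : Fin n → Fin m) {g : Fin n × Fin n → ℝ} (hg : ¬ BlockConstSymGen β g) :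
    ∃ u : Fin n × Fin n → ℝ, (∀ b, BlockConst β b → u ⬝ᵥ corVec (⊤ : SimpleGraph (Fin n)) b = 0) ∧ u ⬝ᵥ g ≠ 0 := by
  classical
  set V : Submodule ℝ (Fin n × Fin n → ℝ) := Submodule.span ℝ (Set.range fun b :
    {b : Fin n → Bool // ∀ p q, β p = β q → b p = b q} => corVec (⊤ : SimpleGraph (Fin n)) b.1) with hV
  have hgV : g ∉ V := fun h => hg (blockConstSym_of_mem_span β h)
  obtain ⟨f, hf, hmap⟩ := Submodule.exists_dual_map_eq_bot_of_notMem hgV inferInstance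
  refine ⟨fun i => f (Pi.single i 1), fun b hb => ?_, ?_⟩
  · rw [← dual_eq_dotProduct]
    have hmem : corVec (⊤ : SimpleGraph (Fin n)) b ∈ V := Submodule.subset_span ⟨⟨b, hb⟩, rfl⟩
    have : f (corVec (⊤ : SimpleGraph (Fin n)) b) ∈ V.map f := Submodule.mem_map_of_mem hmem
    rw [hmap] at this
    simpa using this
  · rwa [← dual_eq_dotProduct]

/-- dot product with a finite linear combination. -/
theorem sum_smul_dotProduct' {ι K : Type} [Fintype ι] [Fintype K] (ε : K → ℝ) (u : K → ι → ℝ) (x : ι → ℝ) :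
    (∑ t, ε t • u t) ⬝ᵥ x = ∑ t, ε t * (u t ⬝ᵥ x) := by
  simp only [dotProduct, Finset.sum_apply, Pi.smul_apply, smul_eq_mul, Finset.sum_mul, Finset.mul_sum]
  rw [Finset.sum_comm]
  exact Finset.sum_congr rfl fun t _ => Finset.sum_congr rfl fun i _ => by ring

/-- ★ GENERIC ADMISSIBLE SEPARATOR: for every finite family of zones there is an admissible direction that is nonzero on
every zone outside `W_β`. -/
theorem exists_admissible_sep (β : Fin n → Fin m) {M : ℕ} (gen : Fin M → (Fin n × Fin n → ℝ)) :
    ∃ c : Fin n × Fin n → ℝ, Admissible β c ∧ ∀ i, ¬ BlockConstSymGen β (gen i) → c ⬝ᵥ gen i ≠ 0 := by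
  classical
  obtain ⟨c₀, hc₀⟩ := admissible_blockDir (n := n) (m := m) β
  -- one separator per bad zone
  have hu : ∀ i : Fin M, ∃ u : Fin n × Fin n → ℝ,
      (∀ b, BlockConst β b → u ⬝ᵥ corVec (⊤ : SimpleGraph (Fin n)) b = 0) ∧
      (¬ BlockConstSymGen β (gen i) → u ⬝ᵥ gen i ≠ 0) := by
    intro i
    by_cases hi : BlockConstSymGen β (gen i)
    · exact ⟨0, fun b _ => by simp, fun h => (h hi).elim⟩
    · obtain ⟨u, hu1, hu2⟩ := exists_sep β hi
      exact ⟨u, hu1, fun _ => hu2⟩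
  choose u hu0 husep using hu
  -- a generic combination `D` of the separators sees every bad zone
  obtain ⟨ε, hε⟩ := exists_generic_comb (K := Fin M) (Finset.univ : Finset (Fin M)) (fun t i => u t ⬝ᵥ gen i)
  set D : Fin n × Fin n → ℝ := ∑ t, ε t • u t with hD
  have hD0 : ∀ b, BlockConst β b → D ⬝ᵥ corVec (⊤ : SimpleGraph (Fin n)) b = 0 := fun b hb => by
    rw [hD, sum_smul_dotProduct']
    exact Finset.sum_eq_zero fun t _ => by rw [hu0 t b hb, mul_zero]
  have hDsep : ∀ i, ¬ BlockConstSymGen β (gen i) → D ⬝ᵥ gen i ≠ 0 := fun i hi => by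
    rw [hD, sum_smul_dotProduct']
    exact hε i (Finset.mem_univ _) ⟨i, husep i hi⟩
  -- a large multiple of `c₀` plus `D`: admissible, and still separating for a generic multiplier
  let bad : Finset (Fin M) := Finset.univ.filter fun i => ¬ BlockConstSymGen β (gen i)
  let prs : Finset (ℝ × ℝ) := bad.image fun i => (c₀ ⬝ᵥ gen i, D ⬝ᵥ gen i)
  have hprs : ∀ p ∈ prs, p.1 ≠ 0 ∨ p.2 ≠ 0 := by
    intro p hp
    obtain ⟨i, hi, rfl⟩ := Finset.mem_image.1 hp
    exact Or.inr (hDsep i (Finset.mem_filter.1 hi).2)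
  let nb : Finset (Fin n → Bool) := Finset.univ.filter fun b => ¬ BlockConst β b
  obtain ⟨L, hL, hLsep⟩ := exists_large_avoid prs hprs
    (∑ b ∈ nb, |D ⬝ᵥ corVec (⊤ : SimpleGraph (Fin n)) b| / (-(c₀ ⬝ᵥ corVec (⊤ : SimpleGraph (Fin n)) b)))
  refine ⟨L • c₀ + D, ⟨fun b hb => ?_, fun b hb => ?_⟩, fun i hi => ?_⟩
  · rw [add_dotProduct, smul_dotProduct, hc₀.1 b hb, hD0 b hb, smul_zero, add_zero]
  · have hneg : c₀ ⬝ᵥ corVec (⊤ : SimpleGraph (Fin n)) b < 0 := hc₀.2 b hb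
    have hbmem : b ∈ nb := Finset.mem_filter.2 ⟨Finset.mem_univ _, hb⟩
    have hle : |D ⬝ᵥ corVec (⊤ : SimpleGraph (Fin n)) b| / (-(c₀ ⬝ᵥ corVec (⊤ : SimpleGraph (Fin n)) b)) ≤
        ∑ b ∈ nb, |D ⬝ᵥ corVec (⊤ : SimpleGraph (Fin n)) b| / (-(c₀ ⬝ᵥ corVec (⊤ : SimpleGraph (Fin n)) b)) :=
      Finset.single_le_sum (f := fun b => |D ⬝ᵥ corVec (⊤ : SimpleGraph (Fin n)) b| /
        (-(c₀ ⬝ᵥ corVec (⊤ : SimpleGraph (Fin n)) b)))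
        (fun b' hb' => div_nonneg (abs_nonneg _) (by
          have := hc₀.2 b' (Finset.mem_filter.1 hb').2; linarith)) hbmem
    have hLgt : |D ⬝ᵥ corVec (⊤ : SimpleGraph (Fin n)) b| / (-(c₀ ⬝ᵥ corVec (⊤ : SimpleGraph (Fin n)) b)) < L :=
      lt_of_le_of_lt hle hL
    rw [add_dotProduct, smul_dotProduct, smul_eq_mul]
    have hpos : 0 < -(c₀ ⬝ᵥ corVec (⊤ : SimpleGraph (Fin n)) b) := by linarith
    have h1 : |D ⬝ᵥ corVec (⊤ : SimpleGraph (Fin n)) b| < L * (-(c₀ ⬝ᵥ corVec (⊤ : SimpleGraph (Fin n)) b)) := by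
      rwa [div_lt_iff₀ hpos] at hLgt
    have h2 := le_abs_self (D ⬝ᵥ corVec (⊤ : SimpleGraph (Fin n)) b)
    nlinarith
  · have hmem : (c₀ ⬝ᵥ gen i, D ⬝ᵥ gen i) ∈ prs :=
      Finset.mem_image.2 ⟨i, Finset.mem_filter.2 ⟨Finset.mem_univ _, hi⟩, rfl⟩
    have := hLsep _ hmem
    rwa [add_dotProduct, smul_dotProduct, smul_eq_mul, mul_comm] 

/-- the value of `c` on a subset sum. -/
theorem dot_subsetSum {M : ℕ} (c : Fin n × Fin n → ℝ) (gen : Fin M → (Fin n × Fin n → ℝ)) (w : Fin n × Fin n → ℝ)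
    (S : Finset (Fin M)) : c ⬝ᵥ subsetSum gen w S = c ⬝ᵥ w + ∑ i ∈ S, c ⬝ᵥ gen i := by
  simp [subsetSum, dotProduct_add, dotProduct_sum]

/-- EXCHANGE: at a maximising subset sum, zones inside have `c·g ≥ 0` and zones outside have `c·g ≤ 0`. -/
theorem maximiser_signs {M : ℕ} (c : Fin n × Fin n → ℝ) (gen : Fin M → (Fin n × Fin n → ℝ)) (w : Fin n × Fin n → ℝ)
    (S : Finset (Fin M)) (hmax : ∀ T, c ⬝ᵥ subsetSum gen w T ≤ c ⬝ᵥ subsetSum gen w S) (i : Fin M) :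
    (i ∈ S → 0 ≤ c ⬝ᵥ gen i) ∧ (i ∉ S → c ⬝ᵥ gen i ≤ 0) := by
  classical
  constructor
  · intro hi
    have h := hmax (S.erase i)
    rw [dot_subsetSum, dot_subsetSum, Finset.sum_erase_eq_sub hi] at h
    linarith
  · intro hi
    have h := hmax (insert i S)
    rw [dot_subsetSum, dot_subsetSum, Finset.sum_insert hi] at h
    linarith

/-- two maximising subset sums differ by a multiple of `J` once every `c`-invisible zone is a multiple of `J`. -/
theorem maximisers_differ_by_J {M : ℕ} (c : Fin n × Fin n → ℝ) (gen : Fin M → (Fin n × Fin n → ℝ))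
    (w : Fin n × Fin n → ℝ) (hJ : ∀ i, c ⬝ᵥ gen i = 0 → ∃ α : ℝ, gen i = α • Jdir n)
    (S S' : Finset (Fin M)) (hS : ∀ T, c ⬝ᵥ subsetSum gen w T ≤ c ⬝ᵥ subsetSum gen w S)
    (hS' : ∀ T, c ⬝ᵥ subsetSum gen w T ≤ c ⬝ᵥ subsetSum gen w S') :
    ∃ α : ℝ, subsetSum gen w S - subsetSum gen w S' = α • Jdir n := by
  classical
  have hzero : ∀ i ∈ S \ S' ∪ S' \ S, c ⬝ᵥ gen i = 0 := by
    intro i hi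
    rcases Finset.mem_union.1 hi with h | h
    · obtain ⟨h1, h2⟩ := Finset.mem_sdiff.1 h
      exact le_antisymm ((maximiser_signs c gen w S' hS' i).2 h2) ((maximiser_signs c gen w S hS i).1 h1)
    · obtain ⟨h1, h2⟩ := Finset.mem_sdiff.1 h
      exact le_antisymm ((maximiser_signs c gen w S hS i).2 h2) ((maximiser_signs c gen w S' hS' i).1 h1)
  have hαex : ∀ i, ∃ α : ℝ, i ∈ S \ S' ∪ S' \ S → gen i = α • Jdir n := by
    intro i
    by_cases hi : i ∈ S \ S' ∪ S' \ S
    · obtain ⟨α, hα⟩ := hJ i (hzero i hi)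
      exact ⟨α, fun _ => hα⟩
    · exact ⟨0, fun h => (hi h).elim⟩
  choose α hα using hαex
  refine ⟨∑ i ∈ S \ S', α i - ∑ i ∈ S' \ S, α i, ?_⟩
  have hdiff : subsetSum gen w S - subsetSum gen w S' = ∑ i ∈ S \ S', gen i - ∑ i ∈ S' \ S, gen i := by
    rw [Finset.sum_sdiff_sub_sum_sdiff (s₂ := S) (s₁ := S') (f := gen)]
    simp only [subsetSum]
    abel
  rw [hdiff, sub_smul, Finset.sum_smul, Finset.sum_smul]
  congr 1
  · exact Finset.sum_congr rfl fun i hi => hα i (Finset.mem_union.2 (Or.inl hi))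
  · exact Finset.sum_congr rfl fun i hi => hα i (Finset.mem_union.2 (Or.inr hi))

/-- ★★ P-R1b FIRST LINK IN KERNEL: the one-cut rung for zonotopes — `ZonoGenBlindAtDecided` HOLDS.  Hence `ClassZ ⇐ CovZonoHard`
outright (`classZ_of_covZonoHard`), (Z1) of the residual spec is unconditional (`zonoEnemy_covers'`), and `FewZonesLawAt` is
reduced to `EquipartitionAvoidance` alone. -/
theorem zonoGenBlindAtDecided_holds : ZonoGenBlindAtDecided := by
  classical
  intro h m' K q r hZ hEF
  obtain ⟨β, ρ, hρ, M, gen, w, hhull, hbl⟩ := hZ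
  -- reindex the subset-sum family by `Fin (K' + 1)`
  obtain ⟨K', ⟨e⟩⟩ : ∃ K', Nonempty (Finset (Fin M) ≃ Fin (K' + 1)) := by
    refine ⟨Fintype.card (Finset (Fin M)) - 1, ⟨(Fintype.equivFin _).trans (finCongr ?_)⟩⟩
    have : 0 < Fintype.card (Finset (Fin M)) := Fintype.card_pos
    omega
  have hq : Set.range (subsetSum gen w ∘ e.symm) = Set.range (subsetSum gen w) :=
    Function.Surjective.range_comp e.symm.surjective _
  have hEF' : HasEFOfSize (corPolytopeGraph (⊤ : SimpleGraph (Fin h)) +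
      convexHull ℝ (Set.range (subsetSum gen w ∘ e.symm))) r := by
    rw [hq, ← hhull]; exact hEF
  -- the generic admissible separator
  obtain ⟨c, hc, hsep⟩ := exists_admissible_sep (n := h) (m := m') β gen
  have hJ : ∀ i, c ⬝ᵥ gen i = 0 → ∃ α : ℝ, gen i = α • Jdir h := by
    intro i hi
    by_cases hb : BlockConstSymGen β (gen i)
    · exact hbl i hb
    · exact absurd hi (hsep i hb)
  have hE : ExposedFibreBlind β (subsetSum gen w ∘ e.symm) := by
    refine ⟨c, hc, fun j j' hj hj' => ?_⟩
    have hS : ∀ T, c ⬝ᵥ subsetSum gen w T ≤ c ⬝ᵥ subsetSum gen w (e.symm j) := fun T => by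
      simpa using hj (e T)
    have hS' : ∀ T, c ⬝ᵥ subsetSum gen w T ≤ c ⬝ᵥ subsetSum gen w (e.symm j') := fun T => by
      simpa using hj' (e T)
    exact maximisers_differ_by_J c gen w hJ _ _ hS hS'
  have hcount := exposedFibreDecided_holds h m' β ρ hρ K' (subsetSum gen w ∘ e.symm) r hE hEF'
  -- `3^m' ≤ (r+1)·2^(m'+1)` ⇒ `(3/2)^(m'-1) ≤ 2(r+1)`
  have hR : (3 : ℝ) ^ m' ≤ (r + 1) * 2 ^ (m' + 1) := by exact_mod_cast hcount
  have h2pos : (0 : ℝ) < 2 ^ m' := by positivity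
  have hmain : (3 / 2 : ℝ) ^ m' ≤ 2 * (r + 1) := by
    rw [div_pow, div_le_iff₀ h2pos]
    calc (3 : ℝ) ^ m' ≤ (r + 1) * 2 ^ (m' + 1) := hR
      _ = 2 * (r + 1) * 2 ^ m' := by ring
  calc (3 / 2 : ℝ) ^ (m' - 1) ≤ (3 / 2) ^ m' := pow_le_pow_right₀ (by norm_num) (Nat.sub_le _ _)
    _ ≤ 2 * (r + 1) := hmain

/-- ★ COROLLARY: class Z is reduced to `CovZonoHard` OUTRIGHT (no rung hypothesis left). -/
theorem classZ_of_covZonoHard (hCov : CovZonoHard) : ClassZ :=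
  classZReduction hCov zonoGenBlindAtDecided_holds

/-- ★ COROLLARY: (Z1) of the residual spec, unconditionally — every zonotopal enemy COVERS the reduction level. -/
theorem zonoEnemy_covers' (C h : ℕ) {M : ℕ} (gen : Fin M → (Fin h × Fin h → ℝ)) (w : Fin h × Fin h → ℝ) (r : ℕ)
    (hE : ZonoEnemy C h gen w r) : Covers h (2 * (Nat.log 2 h + C) ^ C + 4) gen :=
  zonoEnemy_covers zonoGenBlindAtDecided_holds C h gen w r hE

end PastedFromValIdea40

end Summit.ValiantsHypothesis.ValiantsHypothesis.Theorems.FifoMatching.FaceBlind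

end
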